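/-
Copyright: cell pub-balaban-gaps (YM BLITZ Y1, track G1), seat g1-p2 GEN 4 (unit `pub-balaban-gaps-g1-p2`).  Row (D4) NODE O,
OBJECT ∕ MECHANISM level: the BASE OBJECTS in the BLOCK currency (rung §6 of `BLOCKNORM-ADAPTER.md`): domain-localised one-step
operator families on the CUBE torus with OPERATOR-norm letters (`‖F_b(u)‖_{y,y′} ≤ λ` on the domain's cube pairs — print's `B₀` ∕
`O(M⁻¹)`) are `BlockWalkExpansion`s with torus-uniform constants; with `D4WalkBlockProduct` ∕ `D4WalkBlockNeumann` this runs the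
single-scale calculus in print's regime.  HONEST FRAMING: model ∕ mechanism; nothing of Bałaban's constructed or asserted; (D4) NOT
discharged (instance 0∕1); NOT BetaPertH, NOT continuum, NOT Clay.
-/
import Literature.MathematicalPhysics.QuantumFieldTheory.Balaban1983to89.B13DomainKernelWalks
import Summits.QuantumFields.BalabanUV.Gaps.D4WalkBlock

/-!
# `Gaps.D4WalkBlockLocal` — domain-localised operator families with operator-norm letters are BLOCK walk expansions
# (cell pub-balaban-gaps, seat g1-p2 gen 4)

HONEST DEPENDENCY (cell pub-balaban, verbatim): continuum YM on T⁴ ⇐ BetaPertH ∧ nine spine estimates (0/9 proved);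
BetaPertH ⇐ (D1) ∧ (D4) ∧ CAP+tail.

[B9] (3.87)–(3.89) p. 409 (`‖h_□G′_□h_□‖`, `‖K(h_□)G′_□h_□‖ = O(M⁻¹)` as OPERATORS), Thm 3.10 (3.107)–(3.108) p. 416.  The datum is
`B13DomainKernelWalks.DomainTerms` read on the CUBE torus `UT K` (domains = finite sets of cubes of diameter `≤ r` cube steps, anchors,
s-monomials, operator coefficients `u ↦ F_b(u)`); `IsDomainLocalB` = its locality with the letters of the BLOCK currency: `hsuppB`
(blocks of `F_b(u)` vanish off `dom b × dom b`), `hbdB` (`‖F_b(u)‖_{y,y′} ≤ λ` — the OPERATOR norm letter), entries analytic on the ball,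
`|J_b| ≤ m_J`, σ-terms' domains meeting `X`, `≤ n_D` terms per anchor.  `IsDomainLocalB.toFlat`: a block datum is an entrywise one
(entries ≤ blocks), so INTENT-21's σ-structure and partial-sum lemmas apply verbatim; `blockNorm_term_le`: the per-term BLOCK bound
`λe^{κ₁m_J}e^{2ρr}·e^{−ρD_b(y,y′)}`; `blockWalkExpansion_domainLocal`: the family is a `BlockWalkExpansion` with `K̄ = λe^{κ₁m_J}e^{2ρr}·
e^{μr}·n_D·c_μ` at CUBE rates (`r`, `ρ`, `μ` = O(1) in cube units ⟹ every exponential O(1); `c_μ = c₀(1,μ)^ν` O(1)).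
Value: model ∕ mechanism; nothing of Bałaban's asserted; words of row (D4) UNCHANGED.
-/

noncomputable section

namespace Summit.QuantumFields.BalabanUV.Gaps.D4WalkBlockLocal

open Metric Set Finset
open Literature.MathematicalPhysics.QuantumFieldTheory.Balaban1983to89
open Literature.MathematicalPhysics.QuantumFieldTheory.Balaban1983to89.B9SectDWalk (Through MajSumLe DomBy)
open Literature.MathematicalPhysics.QuantumFieldTheory.Balaban1983to89.B9Thm34Ext (toB6)
open Literature.MathematicalPhysics.QuantumFieldTheory.Balaban1983to89.B9Thm37GlueTorus (torusGeom tdist1 tdist1_nonneg)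
open Literature.MathematicalPhysics.QuantumFieldTheory.Balaban1983to89.TreeLengthTorus (TPt)
open Literature.MathematicalPhysics.QuantumFieldTheory.Balaban1983to89.B5TorusCover (UT)
open Literature.MathematicalPhysics.QuantumFieldTheory.Balaban1983to89.B11SectG (RowSum)
open Literature.MathematicalPhysics.QuantumFieldTheory.Balaban1983to89.B13DomainKernelWalks (DomainTerms)
open Summit.QuantumFields.BalabanUV.Gaps.D4WalkBlock
  (blockNorm blockNorm_nonneg blockNorm_smul_le norm_entry_le_blockNorm BlockWalkExpansion)

variable {d N' : ℕ} {ν : ℕ} {K : Fin ν → ℕ} [∀ i, NeZero (K i)]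
variable {p n : Type} [Fintype p] [Fintype n]
variable {E : Type*} [NormedAddCommGroup E] [NormedSpace ℂ E]

/-- **DOMAIN LOCALITY IN THE BLOCK CURRENCY** (Prop-valued hypothesis shape): anchors in their domains; the BLOCKS of `F_b(u)` vanish
off `dom b × dom b` and are bounded by `λ` in OPERATOR norm on the `R`-ball; entries analytic; domain diameter `≤ r` (cube steps);
`|J_b| ≤ m_J`; σ-carrying terms' domains meet `X`; `≤ n_D` terms per anchor cube. [cite: Balaban1985BackgroundPropagators, (3.87)–(3.89) p.409, Thm 3.10 p.416; Balaban1988RG2Cluster, (1.11) p.5, p.13, p.15] -/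
structure IsDomainLocalB (L : DomainTerms d N' ν K p n E) (c : B13.Consts) (cub : p → UT K) (cubn : n → UT K)
    (X : Finset (UT K)) (R lam r : ℝ) (mJ nD : ℕ) : Prop where
  hanchor : ∀ b, L.anchor b ∈ L.dom b
  hsuppB : ∀ b u y y', blockNorm cub cubn (L.op b u) y y' ≠ 0 → y ∈ L.dom b ∧ y' ∈ L.dom b
  han : ∀ b i j, DifferentiableOn ℂ (fun u => L.op b u i j) (ball (0 : E) R)
  hbdB : ∀ b, ∀ u ∈ ball (0 : E) R, ∀ y y', blockNorm cub cubn (L.op b u) y y' ≤ lam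
  hdiam : ∀ b, ∀ z ∈ L.dom b, ∀ z' ∈ L.dom b, tdist1 K z z' ≤ r
  hJ : ∀ b, (L.J b).card ≤ mJ
  hX : ∀ b, (L.J b).Nonempty → (L.dom b ∩ X).Nonempty
  hmult : ∀ z : UT K, (Finset.univ.filter fun b => L.anchor b = z).card ≤ nD

variable {L : DomainTerms d N' ν K p n E}
variable {c : B13.Consts} {cub : p → UT K} {cubn : n → UT K} {X : Finset (UT K)} {R lam r : ℝ} {mJ nD : ℕ}

/-- A block-local datum is an entrywise-local datum for the cube locators (entries are below blocks), so every lemma of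
`B13DomainKernelWalks` applies. [cite: Balaban1985BackgroundPropagators, (3.108) p.416] -/
theorem IsDomainLocalB.toFlat (hL : IsDomainLocalB L c cub cubn X R lam r mJ nD) : L.IsDomainLocal c cub cubn X R lam r mJ nD where
  hanchor := hL.hanchor
  hsupp b u i j h := hL.hsuppB b u (cub i) (cubn j) fun h0 =>
    h (norm_eq_zero.1 (le_antisymm ((norm_entry_le_blockNorm cub cubn (L.op b u) i j).trans h0.le) (norm_nonneg _)))
  han := hL.han
  hbd b u hu i j := (norm_entry_le_blockNorm cub cubn (L.op b u) i j).trans (hL.hbdB b u hu (cub i) (cubn j))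
  hdiam := hL.hdiam
  hJ := hL.hJ
  hX := hL.hX
  hmult := hL.hmult

/-- **THE PER-TERM BLOCK BOUND** of a block-local term: `‖T_b(σ,u)‖_{y,y′} ≤ λe^{κ₁m_J}e^{2ρr}·e^{−ρD_b(y,y′)}` (`ρ ≥ 0`; on the
domain's cube pairs `D_b ≤ 2r`, elsewhere the block vanishes). [cite: Balaban1985BackgroundPropagators, (3.108) p.416; Balaban1988RG2Cluster, (1.11) p.5] -/
theorem blockNorm_term_le (hL : IsDomainLocalB L c cub cubn X R lam r mJ nD) (hκ₁ : 0 ≤ c.κ₁) (hlam : 0 ≤ lam) {ρ : ℝ} (hρ : 0 ≤ ρ)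
    (b : L.B) (σ : TPt d N' → ℂ) (hσ : ∀ j, ‖σ j‖ ≤ Real.exp c.κ₁) (u : E) (hu : u ∈ ball (0 : E) R) (y y' : UT K) :
    blockNorm cub cubn (L.term b σ u) y y' ≤
      (lam * Real.exp (c.κ₁ * mJ) * Real.exp (2 * ρ * r)) * Real.exp (-(ρ * L.dist X b y y')) := by
  have hT : L.term b σ u = (∏ j ∈ L.J b, σ j) • L.op b u := rfl
  by_cases hB : blockNorm cub cubn (L.op b u) y y' = 0
  · calc blockNorm cub cubn (L.term b σ u) y y' ≤ ‖∏ j ∈ L.J b, σ j‖ * blockNorm cub cubn (L.op b u) y y' := by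
          rw [hT]; exact blockNorm_smul_le cub cubn _ _ y y'
      _ = 0 := by rw [hB, mul_zero]
      _ ≤ _ := by positivity
  · obtain ⟨hy, hy'⟩ := hL.hsuppB b u y y' hB
    have hD := DomainTerms.dist_le_two_mul_of_mem hL.toFlat b hy hy'
    have h1 := DomainTerms.norm_monomial_le hκ₁ (hL.hJ b) σ hσ
    have h2 := hL.hbdB b u hu y y'
    have h4 : 1 ≤ Real.exp (2 * ρ * r) * Real.exp (-(ρ * L.dist X b y y')) := by
      rw [← Real.exp_add]
      exact Real.one_le_exp (by nlinarith [mul_nonneg hρ (sub_nonneg.2 hD)])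
    calc blockNorm cub cubn (L.term b σ u) y y' ≤ ‖∏ j ∈ L.J b, σ j‖ * blockNorm cub cubn (L.op b u) y y' := by
          rw [hT]; exact blockNorm_smul_le cub cubn _ _ y y'
      _ ≤ Real.exp (c.κ₁ * mJ) * lam := mul_le_mul h1 h2 (blockNorm_nonneg _ _ _ _ _) (Real.exp_nonneg _)
      _ = (lam * Real.exp (c.κ₁ * mJ)) * 1 := by ring
      _ ≤ (lam * Real.exp (c.κ₁ * mJ)) * (Real.exp (2 * ρ * r) * Real.exp (-(ρ * L.dist X b y y'))) :=
          mul_le_mul_of_nonneg_left h4 (mul_nonneg hlam (Real.exp_nonneg _))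
      _ = (lam * Real.exp (c.κ₁ * mJ) * Real.exp (2 * ρ * r)) * Real.exp (-(ρ * L.dist X b y y')) := by ring

/-- **DOMAIN-LOCALISED OPERATOR FAMILIES WITH OPERATOR-NORM LETTERS ARE BLOCK WALK EXPANSIONS, TORUS-UNIFORMLY** (print's regime at
one scale: all letters in CUBE units).  `IsDomainLocalB` (`λ, κ₁ ≥ 0`), `ρ ≥ 0`, drop `ε`, `κ, μ ≥ 0` with `κ + μ ≤ ρ − ε`, cube row
sum (2.61) at rate `μ` (constant `c_μ`) ⟹ `BlockWalkExpansion` with amplitudes `A = λe^{κ₁m_J}e^{2ρr}`, one-point distances through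
`X_b ∩ X`, rate `ρ`, constant `K̄ = A·e^{μr}·n_D·c_μ`.  The σ-structure, analyticity and partial sums are INTENT-21's by `toFlat`.
[cite: Balaban1985BackgroundPropagators, Thm 3.10 (3.107)–(3.108) p.416, (3.87)–(3.89) p.409; Balaban1988RG2Cluster, (1.11) p.5, p.13, p.15; Balaban1984PropagatorsII, (2.61) p.234] -/
theorem blockWalkExpansion_domainLocal (hL : IsDomainLocalB L c cub cubn X R lam r mJ nD) (hκ₁ : 0 ≤ c.κ₁) (hlam : 0 ≤ lam)
    {ρ ε κ μ cμ : ℝ} (hρ : 0 ≤ ρ) (hκ : 0 ≤ κ) (hμ : 0 ≤ μ) (hwin : κ + μ ≤ ρ - ε)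
    (hrow : RowSum (toB6 (torusGeom K 0 0 0) 0 True) μ cμ) :
    BlockWalkExpansion c cub cubn L.kernel X R ε κ
      ((lam * Real.exp (c.κ₁ * mJ) * Real.exp (2 * ρ * r)) * Real.exp (μ * r) * (nD * cμ))
      L.term L.sigmaCarrying (fun _ => lam * Real.exp (c.κ₁ * mJ) * Real.exp (2 * ρ * r)) (L.dist X) ρ := by
  have hJ := DomainTerms.jointWalkExpansion_domainLocal hL.toFlat hκ₁ hlam hρ hκ hμ hwin hrow
  exact
  { hasSum := hJ.hasSum
    termAnalytic := hJ.termAnalytic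
    majB := fun b σ hσ u hu y y' => blockNorm_term_le hL hκ₁ hlam hρ b σ hσ u hu y y'
    majSum := hJ.majSum
    indep := hJ.indep
    through := hJ.through
    A_nonneg := hJ.A_nonneg
    D_nonneg := hJ.D_nonneg }

end Summit.QuantumFields.BalabanUV.Gaps.D4WalkBlockLocal

end
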